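import Summits.AtomisticToContinuum.Crystallization.Theorems.FrustratedLawDichotomyCellF1RowSet
import Summits.AtomisticToContinuum.Crystallization.Theorems.FrustratedLawDichotomyCellF1cLabels
import Summits.AtomisticToContinuum.Crystallization.Theorems.FrustratedLawDichotomyCellFrameComplete
import Summits.AtomisticToContinuum.Crystallization.Theorems.FrustratedLawDichotomyCoherentInhabited
import Summits.AtomisticToContinuum.Crystallization.Theorems.FrustratedLawDichotomyCellHostTaylor

/-!
# FrustratedLawDichotomy · crux `AperiodicFrustratedLawGap` (stmt-AtomisticToContinuum-27623) — class-A K-file tower, layers 4c + 4d-c: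
the F1 ROW OF RECORD over the COMPLETE template `MF1c`, and its INHABITATION WITNESS (KFILE amendment E2/E4, critic r1861 (A), r1862 (B); hand-2 g48)

TEMPLATE-COMPLETENESS (lens-5 FINDING l.9752): the ed-2 row `KF1` over `MF1` is uninhabited by perturbed full lattices.  This file re-bases #93/#95 on the
complete label set #106 `MF1c` and the `hin`-free class-A chain (362) → #107 `…CellFrameComplete.rowFloor_of_nearIdBox'`:

* §1 `hsep2_aF1c` (pairs over `MF1c`; injectivity of `zT` + Gershgorin `2/5`, list-free) and ★★ `row_F1c` = (260′) with every geometric hypothesis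
  discharged (root, interior inset `hI_aF1` of #93 — `MIF1` is unchanged —, separation; NO window row);
* §2 ★ the ROW OF RECORD `KF1c := ⋃_{F ∈ ratBox BF1} coherentAt (MF1c.image (posL F ∘ aF1)) 2⁻¹⁰ 13`, `measurableSet_KF1c` (hK), the certificate
  interface `CertF1c YF cUp mc` (`2(cUp + mc) ≤ certFloorL MF1c MIF1 0 (posF1 F) (YF F) 2⁻¹⁰ 13` on `BF1`) and ★★ `hfloor_KF1c_of_cert` (hfloor mod the certificate);
* §3 ★★★ NON-VACUITY AS A LEAN FACT (r1861 (E2) «INHABITATION MUST BE A LEAN FACT», r1862 (B) recipe): `latticeF1 := count⌊(aF1 '' parity labels)` — the exact F1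
  lattice at the identity strain — lies in `KF1c` (`latticeF1_mem_KF1c`), by (364) `image_mem_coherentAt_of_complete` with the completeness fact #106
  `mem_Mc_of_window` (every parity site of norm `≤ 13` is a complete label: `(1 − 3ε)·|Tz|² ≤ |Tz|² ≤ 169 ≤ (13 + τ)²`) and `1 ∈ ratBox BF1`.
Imports TREE #95 `…CellF1RowSet` (for `posF1`, `BF1`, `CertF1` vocabulary), #106, #107, (364), (358); 0 sorry.  Tags: [new: K-file layer]; nothing here closes an item.
-/

noncomputable section

namespace Summit.AtomisticToContinuum.Crystallization.Theorems.FrustratedLawDichotomyCellF1cRow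

open MeasureTheory
open scoped BigOperators
open Literature.MathematicalPhysics.StatisticalMechanics (lennardJones rootEnergy)
open Literature.Probability.Process (IsRootedHardCore)
open Summit.AtomisticToContinuum.Crystallization.Theorems.ChargedEnergyGapNegative (E3)
open Summit.AtomisticToContinuum.Crystallization.Theorems.FrustratedLawDichotomyCoherentSets (coherentAt)
open Summit.AtomisticToContinuum.Crystallization.Theorems.FrustratedLawDichotomyCellFrame (certFloorL)
open Summit.AtomisticToContinuum.Crystallization.Theorems.FrustratedLawDichotomyCellMetric (posL norm_sq_posL)
open Summit.AtomisticToContinuum.Crystallization.Theorems.FrustratedLawDichotomyCellRows (ratBox ratBox_subset mem_ratBox measurableSet_ratRow)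
open Summit.AtomisticToContinuum.Crystallization.Theorems.FrustratedLawDichotomyCellTriples (zT sumT zT_inj_on)
open Summit.AtomisticToContinuum.Crystallization.Theorems.FrustratedLawDichotomyCellLinSep (sep_of_linTemplate_rows)
open Summit.AtomisticToContinuum.Crystallization.Theorems.FrustratedLawDichotomyCellFrameComplete (rowFloor_of_nearIdBox')
open Summit.AtomisticToContinuum.Crystallization.Theorems.FrustratedLawDichotomyCoherentInhabited (image_mem_coherentAt_of_complete)
open Summit.AtomisticToContinuum.Crystallization.Theorems.FrustratedLawDichotomyCellHostTaylor (gram_one_self)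
open Summit.AtomisticToContinuum.Crystallization.Theorems.FrustratedLawDichotomyCellF1Frame (T t_rows)
open Summit.AtomisticToContinuum.Crystallization.Theorems.FrustratedLawDichotomyCellF1Labels (MIF1)
open Summit.AtomisticToContinuum.Crystallization.Theorems.FrustratedLawDichotomyCellF1cLabels (MF1c zero_mem_Mc MI_subset_Mc hparc mem_Mc_of_window)
open Summit.AtomisticToContinuum.Crystallization.Theorems.FrustratedLawDichotomyCellF1Symm (BF1)
open Summit.AtomisticToContinuum.Crystallization.Theorems.FrustratedLawDichotomyCellF1Pos (aF1 aF1_eq aF1_root sumSq_aF1)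
open Summit.AtomisticToContinuum.Crystallization.Theorems.FrustratedLawDichotomyCellF1Row (hI_aF1)
open Summit.AtomisticToContinuum.Crystallization.Theorems.FrustratedLawDichotomyCellF1RowSet (posF1)

/-! ## §1 The complete-template row theorem -/

/-- (hsep, squared template form) `(2τ)² < (1 − 3ε)·Σᵢ(aF1 m − aF1 m')ᵢ²` for distinct COMPLETE labels (injectivity of `zT` + Gershgorin `2/5`). -/
theorem hsep2_aF1c : ∀ m ∈ MF1c, ∀ m' ∈ MF1c, m ≠ m' →
    (2 * (1 / 1024 : ℝ)) ^ 2 < (1 - 3 * (1 / 1024 : ℝ)) * ∑ i, (aF1 m i - aF1 m' i) ^ 2 :=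
  sep_of_linTemplate_rows (zT_inj_on MF1c) T t_rows (by norm_num) (by norm_num) (by norm_num)

/-- ★★ THE F1 ROW THEOREM OVER THE COMPLETE TEMPLATE, modulo the K-certificate: if `2·(cUp + mc) ≤ certFloorL MF1c MIF1 0 …` uniformly over the
strain cell, every rooted `7/10`-hard-core NASH configuration of the row has root energy at least `c + mc` ((260′), no window row). -/
theorem row_F1c (YF : Matrix (Fin 3) (Fin 3) ℝ → ℤ × ℤ × ℤ → E3) {c mc cUp : ℝ} (hc : c ≤ cUp)
    (hcert : ∀ F ∈ BF1, 2 * (cUp + mc) ≤ certFloorL MF1c MIF1 0 (fun m => posL F (aF1 m)) (YF F) (1 / 1024) 13)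
    (μ : Measure E3) (hμ : IsRootedHardCore (7 / 10) μ)
    (hNash : ∀ p : E3, μ {p} ≠ 0 → ∀ w : E3, (∀ q : E3, μ {q} ≠ 0 → q ≠ p → w ≠ q) →
      ∑' q : {q : E3 // μ {q} ≠ 0 ∧ q ≠ p}, lennardJones (dist p (q : E3)) ≤
        ∑' q : {q : E3 // μ {q} ≠ 0 ∧ q ≠ p}, lennardJones (dist w (q : E3)))
    (hrow : μ ∈ ⋃ F ∈ BF1, coherentAt (MF1c.image fun m => posL F (aF1 m)) (1 / 1024) 13) :
    c + mc ≤ rootEnergy lennardJones μ :=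
  rowFloor_of_nearIdBox' (1 / 1024) BF1 (fun _ hF => hF) MF1c MIF1 0 aF1 YF (by norm_num) (by norm_num) (by norm_num)
    zero_mem_Mc MI_subset_Mc aF1_root hsep2_aF1c (by norm_num) hI_aF1 hc hcert μ hμ hNash hrow

/-! ## §2 The row of record, its measurability and the certificate interface -/

/-- ★ the F1 ROW OF RECORD over the complete template: coherent (tolerance `2⁻¹⁰`, window `13`) at `posL F ∘ aF1` on `MF1c` for some RATIONAL `F ∈ BF1`. -/
def KF1c : Set (Measure E3) := ⋃ F ∈ ratBox BF1, coherentAt (MF1c.image fun m => posL F (aF1 m)) (1 / 1024) 13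

/-- ★ (hK) the row is measurable (countable union over rational matrices). -/
theorem measurableSet_KF1c : MeasurableSet KF1c := measurableSet_ratRow BF1 MF1c (fun F m => posL F (aF1 m)) (1 / 1024) 13

/-- the row sits inside the real-`F` row. -/
theorem KF1c_subset : KF1c ⊆ ⋃ F ∈ BF1, coherentAt (MF1c.image fun m => posL F (aF1 m)) (1 / 1024) 13 :=
  Set.biUnion_subset_biUnion_left (ratBox_subset BF1)

/-- the K-CERTIFICATE INTERFACE of the complete-template F1 cell (what the Floor file proves): `2·(cUp + mc) ≤ certFloorL MF1c MIF1 0 (posF1 F) (YF F) τ Rc`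
for every `F ∈ BF1`. -/
def CertF1c (YF : Matrix (Fin 3) (Fin 3) ℝ → ℤ × ℤ × ℤ → E3) (cUp mc : ℝ) : Prop :=
  ∀ F ∈ BF1, 2 * (cUp + mc) ≤ certFloorL MF1c MIF1 0 (posF1 F) (YF F) (1 / 1024) 13

/-- ★★ (hfloor) from the certificate interface: every rooted `7/10`-hard-core NASH configuration in `KF1c` has root energy `≥ c + mc` whenever `c ≤ cUp`
and `CertF1c YF cUp mc` (the (228)/(334) `hfloor` line of this row, before transport; with the mark of record add `floor_add_net_hostLike_of_floor`). -/
theorem hfloor_KF1c_of_cert {YF : Matrix (Fin 3) (Fin 3) ℝ → ℤ × ℤ × ℤ → E3} {c mc cUp : ℝ} (hc : c ≤ cUp) (hcert : CertF1c YF cUp mc) :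
    ∀ μ : Measure E3, IsRootedHardCore (7 / 10) μ →
      (∀ p : E3, μ {p} ≠ 0 → ∀ w : E3, (∀ q : E3, μ {q} ≠ 0 → q ≠ p → w ≠ q) →
        ∑' q : {q : E3 // μ {q} ≠ 0 ∧ q ≠ p}, lennardJones (dist p (q : E3)) ≤
          ∑' q : {q : E3 // μ {q} ≠ 0 ∧ q ≠ p}, lennardJones (dist w (q : E3))) →
      μ ∈ KF1c → c + mc ≤ rootEnergy lennardJones μ :=
  fun μ hμ hNash hrow => row_F1c YF hc hcert μ hμ hNash (KF1c_subset hrow)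

/-! ## §3 Non-vacuity: the exact F1 lattice inhabits the row -/

/-- the exact F1 lattice at the identity strain: the counting measure of the template sites of ALL parity labels. -/
def latticeF1 : Measure E3 := Measure.count.restrict ((fun z : ℤ × ℤ × ℤ => posL 1 (aF1 z)) '' {z | Even (sumT z)})

/-- the identity strain is a (rational) member of the strain cell. -/
theorem one_mem_ratBox_BF1 : (1 : Matrix (Fin 3) (Fin 3) ℝ) ∈ ratBox BF1 := by
  have h1 : (Matrix.of fun i j : Fin 3 => (((fun i j : Fin 3 => if i = j then (1 : ℚ) else 0) i j : ℚ) : ℝ)) = (1 : Matrix (Fin 3) (Fin 3) ℝ) := by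
    ext i j
    by_cases h : i = j <;> simp [Matrix.one_apply, h]
  have hB : (1 : Matrix (Fin 3) (Fin 3) ℝ) ∈ BF1 := by
    intro i j
    rw [Matrix.transpose_one, Matrix.mul_one, Matrix.one_apply, sub_self, abs_zero]
    norm_num
  rw [← h1] at hB ⊢
  exact mem_ratBox _ hB

/-- at the identity strain the placed site has the template norm: `‖posL 1 (aF1 z)‖² = Σᵢ (aF1 z)ᵢ²`. -/
theorem norm_sq_posL_one (z : ℤ × ℤ × ℤ) : ‖posL 1 (aF1 z)‖ ^ 2 = ∑ i, aF1 z i ^ 2 := by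
  rw [norm_sq_posL, Matrix.transpose_one, Matrix.mul_one, gram_one_self]

/-- ★ COMPLETENESS AT THE LATTICE: a parity site within the window `‖posL 1 (aF1 z)‖ ≤ 13` is a complete label. -/
theorem mem_Mc_of_norm_le {z : ℤ × ℤ × ℤ} (hpar : Even (sumT z)) (h : ‖posL 1 (aF1 z)‖ ≤ 13) : z ∈ MF1c := by
  refine mem_Mc_of_window hpar ?_
  rw [← aF1_eq, ← norm_sq_posL_one]
  have h0 : 0 ≤ ‖posL 1 (aF1 z)‖ := norm_nonneg _
  nlinarith

/-- ★★★ **THE ROW OF RECORD IS INHABITED**: the exact F1 lattice lies in `KF1c` (clause 1: every complete label's tube holds its own site; clause 2: every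
lattice atom of `B̄(13)` is a template atom, by completeness). The non-vacuity certificate the ed-2 row lacked. -/
theorem latticeF1_mem_KF1c : latticeF1 ∈ KF1c := by
  refine Set.mem_iUnion₂.mpr ⟨1, one_mem_ratBox_BF1, ?_⟩
  exact image_mem_coherentAt_of_complete (fun z : ℤ × ℤ × ℤ => Even (sumT z)) (fun z => posL 1 (aF1 z)) MF1c (by norm_num) hparc
    fun z hz hzR => mem_Mc_of_norm_le hz hzR

end Summit.AtomisticToContinuum.Crystallization.Theorems.FrustratedLawDichotomyCellF1cRow

end
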